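import Summits.BirchSwinnertonDyer.BirchSwinnertonDyer.Theorems.SylvesterTwoHeegnerIndexThmCTorsionBookkeeping
import HarnessLib

/-!
# Route `SylvesterTwoHeegnerIndex` (rung K7t), THEOREM C step (C-d)₂, clause 3 — the CUBIC-TWIST
# identification `E₁(L)^{σ = [ζ]} ≅ E_q(L)^{σ}` along `(x, y) ↦ (c²x, c³y)`, `c³ = q`, made KERNEL

HONEST FRAMING (cell b2b-bsdres, seat x1b GEN 51 = O12 class lead; file `--supports
stmt-BirchSwinnertonDyer-19802 --as helper`, the K7t crux r201 `HSYPointTwoDivisibleSevenModNine` =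
the cell's THEOREM C). MEMO-bsd-cm-two v2.8 §40.1 lists the proof of THEOREM C line by line. Its step
**(C-d)₂** contains, besides Hu–Shu–Yin's printed Galois laws (Thm 2.3 (1), Cor 2.5), the clause
«the identification `E₁(L_{(p)})^{σ_{ω₃} = ω} ≅ E_p(K)` used for `Y`» — [HuShuYin2019] p. 8: «the point
`Y = R − T` belongs to `E₁(L_{(p)})^{σ_{ω₃} = ω^α}` which is identified with `E_p(K)` under the
isomorphism `(x, y) ↦ ((∛p)²x, p·y)`» — recorded in the memo as PRINT and in the tree's fact
`HuShuYin2019.shaAnPair_mul_height_eq_two_zpow_mul_height` as «no tree carrier yet». This file makes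
that clause, and the memo's (C-d) endgame «`Y = φ′(R − T) = 2Y′ + φ′(2T′ − T)`, `Y − 2Y′ ∈ E_p[3]`»,
KERNEL and DEF-FREE, for EVERY pair of Mordell equations `W : y² = x³ + a₆`, `W′ : y² = x³ + c⁶a₆`
over ANY field `L`, any `c ≠ 0`, any cube root of unity `ζ` and any ring endomorphism `σ` of `L` with
`σ c = ζc`:

* §0 cube roots of unity (`z³ = 1 ↔ z ∈ {1, ω, ω²}`; `(σc)³ = c³ ⇒ σc = ζc` with `ζ³ = 1`);
* §1 the CUBIC-TWIST SCALING `φ′ : W(L) ≃+ W′(L)`, `(x, y) ↦ (c²x, c³y)` EXISTS (`exists_twistMap`: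
  the tree's `VariableChange.pointEquiv` of the admissible change `(u, r, s, t) = (c⁻¹, 0, 0, 0)`, which
  carries `W` to `W′`, `twistChange_smul`); below `φ` is ANY map acting by that formula (`hφ0`, `hφ`);
* §2 GALOIS EQUIVARIANCE: with `s`, `s′` ANY maps acting coordinatewise by `σ` on `W(L)`, `W′(L)` (the
  shape of Mathlib's `Affine.Point.map`) and `θ` ANY map acting by `[ζ](x, y) = (ζx, y)`:
  **`s′(φ P) = φ(θ(θ(s P)))`** (`map_twistMap`: `σ(c²x) = ζ²c²·σx`, `σ(c³y) = c³·σy`), `θ³ = 1`, and the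
  FIXED-POINT CRITERION **`s′(φ P) = φ P ↔ s P = θ P`** (`map_twistMap_eq_self_iff`) — i.e.
  `φ′` identifies `W(L)^{σ = [ζ]}` with `W′(L)^{σ}`, Hu–Shu–Yin's identification for `ζ = ω`, `c = ∛p`;
* sequel `…ThmCDescentStep.lean`: the (C-d) ENDGAME — from Hu–Shu–Yin's printed `σR′ = [ω]R′ + t′`,
  `t′ ∈ E₁[√−3]` (HYPOTHESIS) and x1b GEN 50's ONTO lemma, a `T′ ∈ E₁[3]` with `σ(R′ − T′) = [ω](R′ − T′)`,
  so `Y′ := φ(R′ − T′)` is `σ`-fixed and `Y := φ(2R′ − T) ≡ 2Y′` modulo `3`-torsion.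

NO definition, NO named fact, NO sorry; axioms standard. WHAT THIS IS NOT: not THEOREM C — its
Shimura-reciprocity steps (C-a), (C-b)₁, (C-b)₂ and Hu–Shu–Yin's printed laws `σ_{1+3ω₃}P₀ = [ω²]P₀`,
`R′^{σ_{ω₃}} = [ω]R′ + t′` (Thm 2.3 (1), Cor 2.5) stay PRINT/CELL (memo §40.2) and enter here only as
the HYPOTHESIS `hR′`; nothing about `Ш`; closes no item; nothing booked; no label moves.
References: MEMO-bsd-cm-two v2.8 §15.5 (C-d), §40.1; [HuShuYin2019] p. 4 (`E_n : y² = x³ − 432n²`,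
`[ω](x,y) = (ωx, y)`), p. 8 (the identification, `Y = R − T`); [SilvermanAEC2009] III.1 Table 3.1,
proof of III.2.5, X.5.4 (twists by scalings); tree `VariableChangePoints` (`pointEquiv`, PROVED).
-/

set_option autoImplicit false
-- the Summit-side namespace `Summit.BirchSwinnertonDyer.BirchSwinnertonDyer.…` (summit = problem) is mandated by D-0017
set_option linter.dupNamespace false

noncomputable section

open scoped Classical

open WeierstrassCurve WeierstrassCurve.Affine WeierstrassCurve.Affine.Point

namespace Summit.BirchSwinnertonDyer.BirchSwinnertonDyer.Theorems.SylvesterTwoThmCTwist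

open SylvesterTwoCMNormForm SylvesterTwoThmCTorsion

variable {L : Type*} [Field L]

/-! ## §0 Cube roots of unity -/

/-- A cube root of unity is non-zero. [folklore] -/
theorem ne_zero_of_pow_three_eq_one {ζ : L} (hζ : ζ ^ 3 = 1) : ζ ≠ 0 := by
  rintro rfl
  norm_num at hζ

/-- `ζ³ = 1 ⇒ ζ⁶ = 1`. [folklore] -/
theorem pow_six_eq_one {ζ : L} (hζ : ζ ^ 3 = 1) : ζ ^ 6 = 1 := by
  calc ζ ^ 6 = (ζ ^ 3) ^ 2 := by ring
    _ = 1 := by rw [hζ, one_pow]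

/-- `ζ³ = 1 ⇒ (ζ²)³ = 1`. [folklore] -/
theorem sq_pow_three_eq_one {ζ : L} (hζ : ζ ^ 3 = 1) : (ζ ^ 2) ^ 3 = 1 := by
  calc (ζ ^ 2) ^ 3 = (ζ ^ 3) ^ 2 := by ring
    _ = 1 := by rw [hζ, one_pow]

/-- `z³ − 1 = (z − 1)(z − ω)(z − ω²)` over a field containing `ω`, `ω² + ω + 1 = 0`. [folklore] -/
theorem cube_sub_one_factor {ω : L} (hω : ω ^ 2 + ω + 1 = 0) (z : L) :
    z ^ 3 - 1 = (z - 1) * (z - ω) * (z - ω ^ 2) := by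
  linear_combination (z - 1) * (z - ω + 1) * hω

/-- **The cube roots of unity are `1, ω, ω²`**: `z³ = 1 ↔ z = 1 ∨ z = ω ∨ z = ω²`. [folklore] -/
theorem pow_three_eq_one_iff {ω : L} (hω : ω ^ 2 + ω + 1 = 0) (z : L) :
    z ^ 3 = 1 ↔ z = 1 ∨ z = ω ∨ z = ω ^ 2 := by
  rw [← sub_eq_zero, cube_sub_one_factor hω, mul_eq_zero, mul_eq_zero, sub_eq_zero, sub_eq_zero,
    sub_eq_zero, or_assoc]

/-- **A ring endomorphism moves a cube root `c` of a fixed element by a cube root of unity**: if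
`σ(c³) = c³` and `c ≠ 0` then `σ c = ζ·c` with `ζ³ = 1` (`ζ = σc/c`). [folklore] -/
theorem exists_map_eq_rootOfUnity_mul (σ : L →+* L) {c : L} (hc0 : c ≠ 0) (hσ : σ (c ^ 3) = c ^ 3) :
    ∃ ζ : L, ζ ^ 3 = 1 ∧ σ c = ζ * c := by
  refine ⟨σ c / c, ?_, by field_simp⟩
  rw [div_pow, ← map_pow, hσ, div_self (pow_ne_zero 3 hc0)]

/-- With `ω ∈ L`: `σ c ∈ {c, ωc, ω²c}` whenever `σ(c³) = c³`, `c ≠ 0`. [folklore] -/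
theorem map_eq_or_of_map_cube_eq {ω : L} (hω : ω ^ 2 + ω + 1 = 0) (σ : L →+* L) {c : L} (hc0 : c ≠ 0)
    (hσ : σ (c ^ 3) = c ^ 3) : σ c = c ∨ σ c = ω * c ∨ σ c = ω ^ 2 * c := by
  obtain ⟨ζ, hζ, h⟩ := exists_map_eq_rootOfUnity_mul σ hc0 hσ
  rcases (pow_three_eq_one_iff hω ζ).mp hζ with rfl | rfl | rfl
  · exact Or.inl (by rw [h, one_mul])
  · exact Or.inr (Or.inl h)
  · exact Or.inr (Or.inr h)

/-! ## §1 The cubic-twist scaling `(x, y) ↦ (c²x, c³y)` between `y² = x³ + a₆` and `y² = x³ + c⁶a₆` -/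

section Twist

variable {W W' : WeierstrassCurve L} {c : L} (hc0 : c ≠ 0)
  (h1 : W.a₁ = 0) (h2 : W.a₂ = 0) (h3 : W.a₃ = 0) (h4 : W.a₄ = 0)
  (h1' : W'.a₁ = 0) (h2' : W'.a₂ = 0) (h3' : W'.a₃ = 0) (h4' : W'.a₄ = 0) (h6' : W'.a₆ = c ^ 6 * W.a₆)

include hc0 in
/-- `u⁻¹ = c` for the unit `u = c⁻¹`. [folklore] -/
theorem twist_unit_inv : (((Units.mk0 c hc0)⁻¹)⁻¹ : Lˣ).val = c := by
  rw [inv_inv, Units.val_mk0]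

include hc0 in
/-- The new `x`-coordinate under `(c⁻¹, 0, 0, 0)` is `x′ = u⁻²x = c²x`. [cite: SilvermanAEC2009, III.1 Table 3.1] -/
theorem twistChange_toX (x : L) :
    (⟨(Units.mk0 c hc0)⁻¹, 0, 0, 0⟩ : VariableChange L).toX x = c ^ 2 * x := by
  rw [VariableChange.toX, twist_unit_inv hc0]
  ring

include hc0 in
/-- The new `y`-coordinate under `(c⁻¹, 0, 0, 0)` is `y′ = u⁻³y = c³y`. [cite: SilvermanAEC2009, III.1 Table 3.1] -/
theorem twistChange_toY (x y : L) :
    (⟨(Units.mk0 c hc0)⁻¹, 0, 0, 0⟩ : VariableChange L).toY x y = c ^ 3 * y := by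
  rw [VariableChange.toY, twist_unit_inv hc0]
  ring

include hc0 h1 h2 h3 h4 h1' h2' h3' h4' h6' in
/-- **The admissible change `(u, r, s, t) = (c⁻¹, 0, 0, 0)` carries `y² = x³ + a₆` to `y² = x³ + c⁶a₆`**
(`aᵢ′ = u^{−i}aᵢ`, Silverman *AEC* III.1 Table 3.1; for `c = ∛p` and `a₆ = −432`: `E₁ ↦ E_p`,
[HuShuYin2019] p. 8). [cite: SilvermanAEC2009, III.1 Table 3.1] -/
theorem twistChange_smul : (⟨(Units.mk0 c hc0)⁻¹, 0, 0, 0⟩ : VariableChange L) • W = W' := by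
  have hu := twist_unit_inv hc0
  ext
  · rw [variableChange_a₁, h1, h1']
    simp
  · rw [variableChange_a₂, h1, h2, h2']
    simp
  · rw [variableChange_a₃, h1, h3, h3']
    simp
  · rw [variableChange_a₄, h1, h2, h3, h4, h4']
    simp
  · rw [variableChange_a₆, h1, h2, h3, h4, h6', hu]
    simp

include hc0 h1 h2 h3 h4 h1' h2' h3' h4' h6' in
/-- **`(c²x, c³y)` is a nonsingular point of `y² = x³ + c⁶a₆` when `(x, y)` is one of `y² = x³ + a₆`**
(transport of nonsingularity along the admissible change, tree `VariableChange.nonsingular_iff`).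
[cite: SilvermanAEC2009, III.1 Table 3.1 and Prop. III.3.1(b)] -/
theorem nonsingular_twist {x y : L} (hp : W.toAffine.Nonsingular x y) :
    W'.toAffine.Nonsingular (c ^ 2 * x) (c ^ 3 * y) := by
  rw [← twistChange_smul hc0 h1 h2 h3 h4 h1' h2' h3' h4' h6', ← twistChange_toX hc0 x,
    ← twistChange_toY hc0 x y]
  exact (VariableChange.nonsingular_iff W _ x y).mpr hp

include h1 h2 h3 h4 h1' h2' h3' h4' h6' in
/-- **The cubic-twist scaling EXISTS as an additive isomorphism `W(L) ≃+ W′(L)` acting by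
`(x, y) ↦ (c²x, c³y)`**: the tree's `VariableChange.pointEquiv` of `(c⁻¹, 0, 0, 0)` followed by the
transport `Affine.Point.congrEquiv` along `twistChange_smul` — Hu–Shu–Yin's «isomorphism
`(x,y) ↦ ((∛p)²x, py)`» for `c = ∛p`. [cite: HuShuYin2019, p. 8] -/
theorem exists_twistMap : ∃ φ : W.toAffine.Point ≃+ W'.toAffine.Point,
    ∀ (x y : L) (h : W.toAffine.Nonsingular x y),
      φ (.some x y h) = .some (c ^ 2 * x) (c ^ 3 * y)
        (nonsingular_twist hc0 h1 h2 h3 h4 h1' h2' h3' h4' h6' h) := by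
  refine ⟨(VariableChange.pointEquiv W ⟨(Units.mk0 c hc0)⁻¹, 0, 0, 0⟩).trans
    (Affine.Point.congrEquiv (twistChange_smul hc0 h1 h2 h3 h4 h1' h2' h3' h4' h6')), fun x y h => ?_⟩
  simp only [AddEquiv.trans_apply, VariableChange.pointEquiv_some, Affine.Point.congrEquiv_some,
    Affine.Point.some.injEq]
  exact ⟨twistChange_toX hc0 x, twistChange_toY hc0 x y⟩

variable {φ : W.toAffine.Point → W'.toAffine.Point} (hφ0 : φ 0 = 0)
  (hφ : ∀ (x y : L) (h : W.toAffine.Nonsingular x y),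
    φ (.some x y h) = .some (c ^ 2 * x) (c ^ 3 * y) (nonsingular_twist hc0 h1 h2 h3 h4 h1' h2' h3' h4' h6' h))

include hφ0 hφ in
/-- ANY map acting by `(x, y) ↦ (c²x, c³y)`, `𝒪 ↦ 𝒪`, is injective (`c ≠ 0`): `φ P = φ Q ⇒ P = Q`. [folklore] -/
theorem twistMap_injective {P Q : W.toAffine.Point} (hPQ : φ P = φ Q) : P = Q := by
  revert hPQ
  rcases P with _ | ⟨x, y, hp⟩ <;> rcases Q with _ | ⟨x', y', hp'⟩ <;> intro h
  · rfl
  · exfalso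
    change φ 0 = φ (.some x' y' hp') at h
    rw [hφ0, hφ] at h
    exact Affine.Point.some_ne_zero _ h.symm
  · exfalso
    change φ (.some x y hp) = φ 0 at h
    rw [hφ0, hφ] at h
    exact Affine.Point.some_ne_zero _ h
  · rw [hφ, hφ] at h
    simp only [Affine.Point.some.injEq] at h ⊢
    exact ⟨mul_left_cancel₀ (pow_ne_zero 2 hc0) h.1, mul_left_cancel₀ (pow_ne_zero 3 hc0) h.2⟩

/-! ## §2 Galois equivariance `σ(φ P) = φ([ζ]²(σ P))` and the fixed-point criterion -/

variable {σ : L →+* L} {ζ : L} (hζ : ζ ^ 3 = 1) (hσc : σ c = ζ * c) (hσ6 : σ W.a₆ = W.a₆)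

include h1 h2 h3 h4 hσ6 in
/-- **`σ` preserves `W(L)`**: `(σx, σy)` is a nonsingular point of `y² = x³ + a₆` when `(x, y)` is and
`σ a₆ = a₆` (apply `σ` to the equation and to the non-vanishing partial derivative; `σ` is injective).
[cite: SilvermanAEC2009, I.§1 and VIII.§1] -/
theorem nonsingular_map {x y : L} (hp : W.toAffine.Nonsingular x y) :
    W.toAffine.Nonsingular (σ x) (σ y) := by
  rw [Affine.nonsingular_iff, Affine.equation_iff] at hp ⊢
  simp only [h1, h2, h3, h4, zero_mul, mul_zero, add_zero, sub_zero, ne_eq] at hp ⊢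
  obtain ⟨heq, hns⟩ := hp
  refine ⟨?_, ?_⟩
  · have e := congrArg σ heq
    rw [map_pow, map_add, map_pow, hσ6] at e
    exact e
  · rcases hns with h | h
    · left
      intro h'
      apply h
      have e : σ (3 * x ^ 2) = 0 := by rw [map_mul, map_pow, map_ofNat]; exact h'.symm
      exact ((map_eq_zero σ).mp e).symm
    · right
      intro h'
      apply h
      exact σ.injective (by rw [map_neg]; exact h')

include hζ hσc hσ6 h6' in
/-- `σ` fixes `a₆′ = c⁶a₆` too: `σ(c⁶a₆) = (ζc)⁶·a₆ = c⁶a₆` (`ζ⁶ = 1`). [folklore] -/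
theorem map_a₆_twist : σ W'.a₆ = W'.a₆ := by
  rw [h6', map_mul, map_pow, hσc, hσ6, mul_pow, pow_six_eq_one hζ, one_mul]

include hζ h1 h2 h3 h4 in
/-- **`(ζx, y)` is a nonsingular point of `y² = x³ + a₆` when `(x, y)` is** (`ζ³ = 1`); for `ζ = ω` this is
`SylvesterTwoCMNormForm.nonsingular_omega_mul`. [cite: HuShuYin2019, p. 4] -/
theorem nonsingular_rootMul {x y : L} (hp : W.toAffine.Nonsingular x y) :
    W.toAffine.Nonsingular (ζ * x) y := by
  have hζ0 := ne_zero_of_pow_three_eq_one hζ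
  rw [Affine.nonsingular_iff, Affine.equation_iff] at hp ⊢
  simp only [h1, h2, h3, h4, zero_mul, mul_zero, add_zero, sub_zero, ne_eq] at hp ⊢
  obtain ⟨heq, hns⟩ := hp
  refine ⟨by rw [heq, mul_pow, hζ, one_mul], ?_⟩
  rcases hns with h | h
  · left
    intro h'
    apply h
    have e : (3 : L) * (ζ * x) ^ 2 = ζ ^ 2 * (3 * x ^ 2) := by ring
    rw [e] at h'
    exact ((mul_eq_zero.mp h'.symm).resolve_left (pow_ne_zero 2 hζ0)).symm
  · right
    exact h

variable {s : W.toAffine.Point → W.toAffine.Point} (hs0 : s 0 = 0)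
  (hs : ∀ (x y : L) (h : W.toAffine.Nonsingular x y),
    s (.some x y h) = .some (σ x) (σ y) (nonsingular_map h1 h2 h3 h4 hσ6 h))
  {s' : W'.toAffine.Point → W'.toAffine.Point} (hs0' : s' 0 = 0)
  (hs' : ∀ (x y : L) (h : W'.toAffine.Nonsingular x y),
    s' (.some x y h) = .some (σ x) (σ y)
      (nonsingular_map h1' h2' h3' h4' (map_a₆_twist h6' hζ hσc hσ6) h))
  {θ : W.toAffine.Point → W.toAffine.Point} (hθ0 : θ 0 = 0)
  (hθ : ∀ (x y : L) (h : W.toAffine.Nonsingular x y),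
    θ (.some x y h) = .some (ζ * x) y (nonsingular_rootMul h1 h2 h3 h4 hζ h))

include hθ0 hθ in
/-- **`[ζ]³ = 1` on points**: `θ(θ(θ P)) = P` for any `θ` acting by `(x, y) ↦ (ζx, y)`, `ζ³ = 1`. [folklore] -/
theorem rootMul_rootMul_rootMul (P : W.toAffine.Point) : θ (θ (θ P)) = P := by
  rcases P with _ | ⟨x, y, hp⟩
  · show θ (θ (θ 0)) = 0
    rw [hθ0, hθ0, hθ0]
  · rw [hθ, hθ, hθ]
    simp only [Affine.Point.some.injEq, and_true]
    linear_combination x * hζ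

include hφ0 hφ hs0 hs hs0' hs' hθ0 hθ in
/-- **GALOIS EQUIVARIANCE of the cubic-twist scaling**: `σ(φ P) = φ([ζ]²(σ P))` — on coordinates
`σ(c²x) = (ζc)²σx = ζ²c²σx` and `σ(c³y) = (ζc)³σy = c³σy`; this is the twist cocycle
`σ ↦ φ ∘ (φ^σ)⁻¹ = [ζ²]` of the scaling (Silverman *AEC* X.5.4 for `j = 0`), written for ANY maps
`s, s′` acting coordinatewise by `σ` (Mathlib's `Affine.Point.map`), ANY `θ` acting by `[ζ]` and ANY
`φ` acting by `(x,y) ↦ (c²x, c³y)`. [cite: SilvermanAEC2009, Prop. X.5.4] -/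
theorem map_twistMap (P : W.toAffine.Point) : s' (φ P) = φ (θ (θ (s P))) := by
  rcases P with _ | ⟨x, y, hp⟩
  · show s' (φ 0) = φ (θ (θ (s 0)))
    rw [hs0, hθ0, hθ0, hφ0, hs0']
  · rw [hφ, hs', hs, hθ, hθ, hφ]
    simp only [Affine.Point.some.injEq]
    refine ⟨?_, ?_⟩
    · rw [map_mul, map_pow, hσc]
      ring
    · rw [map_mul, map_pow, hσc]
      linear_combination c ^ 3 * σ y * hζ

include hφ0 hφ hs0 hs hs0' hs' hθ0 hθ in
/-- **THE FIXED-POINT CRITERION (Hu–Shu–Yin's identification)**: `σ(φ P) = φ P ↔ σ P = [ζ]P` —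
`φ` identifies the `[ζ]`-eigenspace `W(L)^{σ = [ζ]}` of `σ` on `W : y² = x³ + a₆` with the `σ`-FIXED
points of the cubic twist `W′ : y² = x³ + c⁶a₆` (`σ c = ζc`); for `a₆ = −432`, `c = ∛p`, `ζ = ω`,
`σ = σ_{ω₃}`: «`E₁(L_{(p)})^{σ_{ω₃} = ω}` is identified with `E_p(K)` under `(x,y) ↦ ((∛p)²x, py)`»
(the `σ`-fixed points of `E_p(L_{(p)})` being `E_p(K)` by Galois descent). [cite: HuShuYin2019, p. 8] -/
theorem map_twistMap_eq_self_iff (P : W.toAffine.Point) : s' (φ P) = φ P ↔ s P = θ P := by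
  rw [map_twistMap hc0 h1 h2 h3 h4 h1' h2' h3' h4' h6' hφ0 hφ hζ hσc hσ6 hs0 hs hs0' hs' hθ0 hθ P]
  constructor
  · intro h
    have h' := twistMap_injective hc0 h1 h2 h3 h4 h1' h2' h3' h4' h6' hφ0 hφ h
    calc s P = θ (θ (θ (s P))) := (rootMul_rootMul_rootMul h1 h2 h3 h4 hζ hθ0 hθ (s P)).symm
      _ = θ P := by rw [h']
  · intro h
    rw [h, rootMul_rootMul_rootMul h1 h2 h3 h4 hζ hθ0 hθ P]

include hs0 hs hθ0 hθ in
/-- **`σ` commutes with `[ζ]` when `σ ζ = ζ`**: `s(θ P) = θ(s P)`. [folklore] -/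
theorem map_rootMul_comm (hσζ : σ ζ = ζ) (P : W.toAffine.Point) : s (θ P) = θ (s P) := by
  rcases P with _ | ⟨x, y, hp⟩
  · show s (θ 0) = θ (s 0)
    rw [hθ0, hs0, hθ0]
  · rw [hθ, hs, hs, hθ]
    simp only [Affine.Point.some.injEq, and_true]
    rw [map_mul, hσζ]

include hs0 hs hθ0 hθ in
/-- **The square of the Galois element**: if `σ P = [ζ]P` and `σ ζ = ζ` then `σ(σ P) = [ζ]([ζ] P)` —
with `σ²c = ζ²c` and `([ζ]²)² = [ζ²]²` this is the criterion for `σ²` (all of `Gal(L_{(p)}/K) = ⟨σ⟩`).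
[folklore] -/
theorem map_map_eq_of_map_eq (hσζ : σ ζ = ζ) {P : W.toAffine.Point} (hP : s P = θ P) :
    s (s P) = θ (θ P) := by
  rw [hP, map_rootMul_comm h1 h2 h3 h4 hζ hσ6 hs0 hs hθ0 hθ hσζ, hP]

end Twist

end Summit.BirchSwinnertonDyer.BirchSwinnertonDyer.Theorems.SylvesterTwoThmCTwist

end
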